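import Mathlib
import HarnessLib
import Summits.NavierStokesRegularity.NavierStokesRegularity.Theorems.TaylorModelRungThreeCertificateFormat
import Summits.NavierStokesRegularity.NavierStokesRegularity.Theorems.TaylorModelRungThreeCertificateSoundBridge
import Summits.NavierStokesRegularity.NavierStokesRegularity.Theorems.TaylorModelRungThreeCertificateReadouts

/-!
# Crux K1b-DR (stmt-NavierStokesRegularity-23954), line `taylor-model` — the executable checker of the
# `StageNumerics` block of `CertData.Valid` (CERT-CONTRACT-23954 v1 §4 STAGENUMERICS), format of record p602753

`Theorems/TaylorModelRungThreeCertificateFormat.lean` fixes the tables `TaylorModelCert.CertTables K`, their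
interpretation `CertTables.toCertData φ T : TaylorChain.CertData` and the checker of the `Chain` block;
`…CertificateReadouts.lean` (p606486) adds the `Readouts` checker and the surrogate record `ReadoutAux K`
(`θ = θnum/θden`, upper surrogate `tv ≥ √(10·Cg·2^(−7(Ka+1)))`). This module adds the Boolean checker of the
`StageNumerics` block (`CertData.StageNumerics`: clauses (N)+(U)+(DIST) per stage and the bilinear bound (B)),
over the SAME tables plus one more small record `StageAux K` of one-sided dyadic SURROGATES, each certified by
an exact check in `K` (`checkStageAux`):

* `pU ≥ 2^(−θ)` (certified by `pU > 0 ∧ 1 ≤ pU^θden·2^θnum`) — for the amplitude clause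
  `2^(−θ)·Lv(nx j) ≤ as − Λδτs·ω₁` (an UPPER surrogate is what a sufficient check needs; `ReadoutAux.pθ` is a
  lower one);
* `PU ≥ 2^θ` (certified by `PU > 0 ∧ 2^θnum ≤ PU^θden`) and `tv` — for the half-widths of the box of the
  exit-functional clause (U), checked as `Σ_c |ell_c|·halfwidth_c ≤ s` (sup of a linear functional over a box);
* `r34U ≥ 2^(3(Kb+1)/4)` (certified by `r34U ≥ 0 ∧ 2^(3(Kb+1)) ≤ r34U⁴`) and the list `rM` with
  `rM_k ≥ √(M_k²/2 + η₀ W_k)` (certified by squaring) — for the truncation-defect clause (DIST);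
* sign guards `0 ≤ η₀, 0 ≤ τs, 0 ≤ Cb, 0 ≤ Cg, 0 ≤ M` (all implied by `Static`, re-checked here so that the
  soundness of this block does not depend on that one) and the window facts `0 ≤ Kb`, `1 ≤ Ka`.

The TRUNCATION-DEFECT clause (⚠ in the contract): for a target window coordinate `(i,k)` the monomials of
Tao's `quadTerm` have their two factors on shells `k − μ₃ + μ₁`, `k − μ₃ + μ₂ ∈ {k−1, k, k+1}`; the difference
`quadTerm(y) − quadTerm(trunc y)` is the sum of the monomials with AT LEAST ONE factor off the window, which
happens only on the boundary rows `k = −Kb` (shift `(0,0,1)`: both factors on shell `−Kb−1`) and `k = Ka` (shifts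
`(1,0,0)`, `(0,1,0)`: one factor on shell `Ka+1`); the checker computes, for EVERY window coordinate, the sum over
`(a, b, μ)` of `|coef|·B(k₁)·B(k₂)` restricted to the monomials with an off-window factor, with `B = M` on the
window, `6/5·Cb·r34U` at shell `−Kb−1`, `tv` at shell `Ka+1` (`defectK`), and tests
`defectK + η₀·2^(2k)·rM_k ≤ δ·ω_k`. The BILINEAR bound (B) is the row-sum test
`Σ_{(a,b,μ): both factors on the window} |coef|·ω_{k₁}·ω_{k₂} ≤ bb·ω_k` (`bilinK`).

Window coordinates, list coding and junk conventions exactly as in the format file (`CertTables.wi/wk` of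
`…CertificateSoundBridge`). SOUNDNESS (`StageNumerics` of `toCertData φ T` from `checkStageNumerics = true` under a
monotone `φ : K →+* ℝ` and `CoefOK φ T`) is proved in the `…CertificateStageNumerics{Sound,Defect,Bilin}` files; this
file asserts nothing.

MODEL-lattice bookkeeping only (rung TL-M3, Tao-type averaged cascade); nothing here is a statement about the
Navier–Stokes equations.
-/

-- the sub-problem namespace repeats the summit name by design (D-0017)
set_option linter.dupNamespace false

namespace Summit.NavierStokesRegularity.NavierStokesRegularity.Theorems.TaylorModelCert

open scoped BigOperators
open Literature.Analysis.FluidPDE.TaoCascade Literature.Analysis.FluidPDE.TaoCascade.TaylorChain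

/-- Auxiliary SURROGATE data for the `StageNumerics` checker (upper surrogates; see the module docstring):
`pU ≥ 2^(−θ)`, `PU ≥ 2^θ`, `r34U ≥ 2^(3(Kb+1)/4)`, and `rM`, indexed by the window shell `k + Kb`, with
`rM_k ≥ √(M_k²/2 + η₀ W_k)`. [folklore] -/
structure StageAux (K : Type) where
  (pU PU r34U : K)
  rM : List K

namespace CertTables

variable {K : Type} [Field K] [LinearOrder K]

/-! ### Table look-ups on the window shells -/

/-- `M` at the window shell with index `kk = k + Kb` (the `M`/`W` tables are indexed from shell `−Kb−1`). [folklore] -/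
def Mw (T : CertTables K) (kk : ℕ) : K := vget T.M (kk + 1)

/-- `W` at the window shell with index `kk = k + Kb`. [folklore] -/
def Ww (T : CertTables K) (kk : ℕ) : K := vget T.W (kk + 1)

/-- `ω j` at an INTEGER shell `k` (table value on the window, `1` off it — as in `toCertData`). [folklore] -/
def wShell (T : CertTables K) (j : ℕ) (k : ℤ) : K :=
  if -T.Kb ≤ k ∧ k ≤ T.Ka then vget (T.stage j).ω (k + T.Kb).toNat else 1

/-- The weight `ω j 1` of shell `1`. [folklore] -/
def w1 (T : CertTables K) (j : ℕ) : K := T.wShell j 1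

/-! ### Global checks of the surrogates and sign guards -/

/-- The exact certification of the surrogates of `StageAux` (and of `θnum/θden`, `tv` of `ReadoutAux`) against the
global tables, the window facts `0 ≤ Kb`, `1 ≤ Ka`, and the sign guards `0 ≤ η₀, τs, Cb, Cg, M`. [folklore] -/
def checkStageAux (T : CertTables K) (A : ReadoutAux K) (B : StageAux K) : Bool :=
  decide (0 ≤ T.Kb) && decide (1 ≤ T.Ka) &&
  decide (0 < A.θden) && decide (T.θ * ((A.θden : ℕ) : K) = ((A.θnum : ℕ) : K)) &&
  decide (0 < B.pU) && decide (1 ≤ B.pU ^ A.θden * (2 : K) ^ A.θnum) &&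
  decide (0 < B.PU) && decide ((2 : K) ^ A.θnum ≤ B.PU ^ A.θden) &&
  decide (0 ≤ B.r34U) && decide ((2 : K) ^ (3 * (T.Kb + 1).toNat) ≤ B.r34U ^ 4) &&
  decide (0 ≤ A.tv) && decide (10 * T.Cg ≤ A.tv ^ 2 * (2 : K) ^ (7 * (T.Ka + 1).toNat)) &&
  decide (0 ≤ T.η₀) && decide (0 ≤ T.τs) && decide (0 ≤ T.Cb) && decide (0 ≤ T.Cg) &&
  allN (T.m + 2) (fun t => decide (0 ≤ vget T.M t)) &&
  allN T.m (fun kk => decide (0 ≤ vget B.rM kk) &&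
    decide ((1 / 2 : K) * T.Mw kk ^ 2 + T.η₀ * T.Ww kk ≤ vget B.rM kk ^ 2))

/-! ### The clause-family checkers of `StageNumerics` at stage `j` -/

/-- SCALARS of stage `j`: `nx ≤ N₀`, `1 ≤ Lv`, `0 ≤ s l` (listed faces), `0 < κ`, `0 ≤ Λ`, `0 ≤ δ`, `0 < ω` on the
window shells, `Λδτs < κ`, and the amplitude clause against the surrogate: `0 ≤ Lv(nx)`, `0 < as`,
`pU·Lv(nx) ≤ as − Λδτs·ω₁`. [folklore] -/
def checkSN_scalars (T : CertTables K) (j : ℕ) (B : StageAux K) : Bool :=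
  let G := T.stage j
  let Gn := T.stage G.nx
  decide (G.nx ≤ T.N₀) && decide (1 ≤ G.Lv) && allN G.s.length (fun l => decide (0 ≤ vget G.s l)) &&
  decide (0 < G.κ) && decide (0 ≤ G.Λ) && decide (0 ≤ G.δ) &&
  allN T.m (fun kk => decide (0 < vget G.ω kk)) &&
  decide (G.Λ * G.δ * T.τs < G.κ) &&
  decide (0 ≤ Gn.Lv) && decide (0 < G.as) &&
  decide (B.pU * Gn.Lv ≤ G.as - G.Λ * G.δ * T.τs * T.w1 j)

/-- Surrogate half-width of the exit box at window coordinate `c` (shell `k = wk c`):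
`(Λδτs·ω_{k+1} + M_{k+1}·Λδτs·ω₁/as)·PU` if `k + 1 ≤ Ka`, else (the top shell `k = Ka`) `tv·PU·Λδτs·ω₁/as`. [folklore] -/
def exitHW (T : CertTables K) (j : ℕ) (A : ReadoutAux K) (B : StageAux K) (c : ℕ) : K :=
  let G := T.stage j
  let L := G.Λ * G.δ * T.τs
  if c % T.m + 1 < T.m then (L * T.wgt j (c + 1) + T.Mw (c % T.m + 1) * L * T.w1 j / G.as) * B.PU
  else A.tv * B.PU * L * T.w1 j / G.as

/-- EXIT-FUNCTIONAL clause (U) of stage `j`: for every listed face `l` of the successor stage `nx j`,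
`Σ_c |ell_c|·exitHW_c ≤ s l` (sup of the face functional over the surrogate box), and `0 ≤ s l` on the listed
faces (the unlisted functionals are `0`). [folklore] -/
def checkSN_exit (T : CertTables K) (j : ℕ) (A : ReadoutAux K) (B : StageAux K) : Bool :=
  let G := T.stage j
  let Gn := T.stage G.nx
  allN Gn.s.length (fun l => decide (0 ≤ vget Gn.s l)) &&
  allN Gn.ell.length (fun l =>
    decide (sumN T.n (fun c => |vget (Gn.ell.getD l []) c| * T.exitHW j A B c) ≤ vget Gn.s l))

/-- Surrogate bound of `|y|` on the factor shell `k₁`: `M` on the window, `6/5·Cb·r34U` on shell `−Kb−1`, `tv` on shell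
`Ka+1` (other shells do not occur as factor shells of a window target; value `0`). [folklore] -/
def yBound (T : CertTables K) (A : ReadoutAux K) (B : StageAux K) (k₁ : ℤ) : K :=
  if -T.Kb ≤ k₁ ∧ k₁ ≤ T.Ka then T.Mw (k₁ + T.Kb).toNat
  else if k₁ = -T.Kb - 1 then 6 / 5 * T.Cb * B.r34U
  else if k₁ = T.Ka + 1 then A.tv else 0

/-- The two factor shells of the monomial `(a, b, μ)` at target shell `k`: `k − μ₃ + μ₁` and `k − μ₃ + μ₂`
(`μ = shifts[μi]`). [folklore] -/
def fShell₁ (μi : ℕ) (k : ℤ) : ℤ := k - (shifts.getD μi (0, 0, 0)).2.2 + (shifts.getD μi (0, 0, 0)).1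

/-- See `fShell₁`. [folklore] -/
def fShell₂ (μi : ℕ) (k : ℤ) : ℤ := k - (shifts.getD μi (0, 0, 0)).2.2 + (shifts.getD μi (0, 0, 0)).2.1

/-- TRUNCATION-DEFECT majorant at window target `(i, k)`: the sum over the monomials with at least one factor OFF the
window of `|coef|·yBound(k₁)·yBound(k₂)`. [folklore] -/
def defectK (T : CertTables K) (A : ReadoutAux K) (B : StageAux K) (i : Fin 4) (k : ℤ) : K :=
  sumN 4 fun a => sumN 4 fun b => sumN 4 fun μi =>
    if (-T.Kb ≤ fShell₁ μi k ∧ fShell₁ μi k ≤ T.Ka) ∧ (-T.Kb ≤ fShell₂ μi k ∧ fShell₂ μi k ≤ T.Ka) then 0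
    else |T.coefAt ⟨a % 4, Nat.mod_lt _ (by omega)⟩ ⟨b % 4, Nat.mod_lt _ (by omega)⟩ i μi k| *
      T.yBound A B (fShell₁ μi k) * T.yBound A B (fShell₂ μi k)

/-- TRUNCATION-DEFECT clause (DIST) of stage `j`: `defectK + η₀·2^(2k)·rM_k ≤ δ·ω_k` at every window coordinate.
[folklore] -/
def checkSN_defect (T : CertTables K) (j : ℕ) (A : ReadoutAux K) (B : StageAux K) : Bool :=
  let G := T.stage j
  allN T.n fun c =>
    decide (T.defectK A B (T.wi c) (T.wk c) + T.η₀ * (2 : K) ^ (2 * T.wk c) * vget B.rM (c % T.m) ≤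
      G.δ * T.wgt j c)

/-- BILINEAR row sum at window target `(i, k)`: the sum over the monomials with BOTH factors on the window of
`|coef|·ω_{k₁}·ω_{k₂}`. [folklore] -/
def bilinK (T : CertTables K) (j : ℕ) (i : Fin 4) (k : ℤ) : K :=
  sumN 4 fun a => sumN 4 fun b => sumN 4 fun μi =>
    if (-T.Kb ≤ fShell₁ μi k ∧ fShell₁ μi k ≤ T.Ka) ∧ (-T.Kb ≤ fShell₂ μi k ∧ fShell₂ μi k ≤ T.Ka) then
      |T.coefAt ⟨a % 4, Nat.mod_lt _ (by omega)⟩ ⟨b % 4, Nat.mod_lt _ (by omega)⟩ i μi k| *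
        T.wShell j (fShell₁ μi k) * T.wShell j (fShell₂ μi k)
    else 0

/-- BILINEAR bound (B) of stage `j`: `0 ≤ bb` and `bilinK ≤ bb·ω_k` at every window coordinate. [folklore] -/
def checkSN_bilin (T : CertTables K) (j : ℕ) : Bool :=
  let G := T.stage j
  decide (0 ≤ G.bb) && allN T.n fun c => decide (T.bilinK j (T.wi c) (T.wk c) ≤ G.bb * T.wgt j c)

/-- The `StageNumerics` checks of stage `j`. [folklore] -/
def checkStageNumericsStage (T : CertTables K) (j : ℕ) (A : ReadoutAux K) (B : StageAux K) : Bool :=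
  T.checkSN_scalars j B && T.checkSN_exit j A B && T.checkSN_defect j A B && T.checkSN_bilin j

/-- STAGENUMERICS CHECK: the surrogate certification and all stages `j ≤ N₀`. [folklore] -/
def checkStageNumerics (T : CertTables K) (A : ReadoutAux K) (B : StageAux K) : Bool :=
  T.checkStageAux A B && allN (T.N₀ + 1) fun j => T.checkStageNumericsStage j A B

end CertTables

end Summit.NavierStokesRegularity.NavierStokesRegularity.Theorems.TaylorModelCert
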